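/-
M16a (decomp-mm-lens-5 g29) — THE FLAT / TWISTED DICHOTOMY FOR RUNG `K = 2` OF BOP′.
Constant kernel fields = globally tangent vectors; the CONST-DEFLATABLE class (⊇ flat ∧ order `2`
⊇ constant rows ⊇ `I²`) deflates at cost `4·cost + n²`; the TEST-ISOLATED class is pure for free; the residual
of hand 1 is re-typed to the HIDDEN ∧ TWISTED class in the window `β' ≤ ω` — NEC there, and weaker
than `UniformKernelFieldDeflation`.  No sorry.
-/
import Mathlib
import Summits.MatrixMultiplication.Statement
import Summits.MatrixMultiplication.MatrixMultiplication.Theorems.GraphEquationsTangentDeflation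

/-!
# Graph equations — the flat / twisted dichotomy at rung `K = 2`

Supporting kernels for the crux `MultiplicityReduction` of route `GraphEquations`
(line `purisplit`, stub `BoundedOrderPurification`, rung `K = 2`:
`EqAdmissibleIdealIso β 2 → EqAdmissiblePure β'` for `2 ≤ β < β'`).

The tree closes rung `2` from the residual `UniformKernelFieldDeflation β β'` ALONE
(`boundedOrderPurification_two_of_uniform'`), a `∀ (E, y)` demand for a cheap KERNEL FIELD.  That
residual is sufficient but NOT necessary and is posed on every correct order-`2` system.  This file
carves three STRUCTURAL CLASSES out of it by theorems and leaves a strictly smaller residual.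

* **Constant kernel fields are the global tangent vectors**
  (`EqSystem.derivC_const_mem_graphIdeal_iff_globalTangent`): the constant field `γ` satisfies
  `D_γ t ∈ I` for every test `t` iff `γ ∈ ker J_C(graphPoint y')` for EVERY `y'` (the `→` is
  `jacobianC_mulVec_eq_zero_of_derivC_const_mem`; the `←` is `MvPolynomial.funext` on the row
  identity `g_q(y') = (∂t/∂c_q)(graphPoint y')`).
* **R1 — the CONST-DEFLATABLE class deflates at linear cost**
  (`EqSystem.ConstDeflatable`, `exists_reduced_deflation_of_constDeflatable`): if some constant
  kernel field deflates `E` to order `1` over `y`, then `E` has a CORRECT deflation REDUCED at the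
  graph point over `y` of cost `≤ 4·cost E + n²` (forward-mode AD with `constSystem γ`).  The class
  contains the FLAT pairs (`EqSystem.FlatAt`: every tangent vector at `graphPoint y` is globally
  tangent; `ConstDeflatable.of_flatAt`, via `deflate_tangent`), hence the constant-row systems of
  M15e (`flatAt_of_constRows`) and the `I²` systems of M15d.
* **The TEST-ISOLATED class is pure for free** (tree: `InitIsolatedAt.pureIsolated`,
  `InitIsolatedAt K y → PureIsolated (2K)`): if the TESTS themselves (not merely members of their
  ideal) are initially isolated to order `K₀` over `y`, the system already witnesses
  `EqAdmissiblePure` at the SAME exponent — no deflation needed.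
* **The window above `ω` is free** (tree: `eqAdmissibleIdealIso_one_of_omega_lt`).
* **The residual, re-typed** (`HiddenTwistedDeflation K₀ β β'`, UNDECIDED): the kernel-field demand
  restricted to pairs `(E, y)` that are HIDDEN (tests not initially isolated to order `K₀` over `y`:
  isolation comes only from non-test ideal members, e.g. hidden squares `f_q² + Σ m·r`) AND TWISTED
  (no constant kernel field deflates `E` over `y`: the deflation directions at `y` do not extend to
  global tangent vectors).  It is WEAKER than the old residual (`hiddenTwistedDeflation_of_uniform`),
  antitone in `K₀` (`HiddenTwistedDeflation.mono_order`), NEC in the window `β' ≤ ω`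
  (`nec_hiddenTwistedDeflation_window`, vacuously: under `S` the window is empty), and SUFFICIENT:
  `boundedOrderPurification_two_of_hiddenTwisted` closes rung `2` from the windowed residual ALONE
  (cases per `n`: test-isolated / const-deflatable / residual; uniform order `2·max K₀ 1`).
  A hidden ∧ twisted pair: tests `{a₁₁·f₁₁, f₂₁ + f₁₁², f₂₁, f₁₂², f₂₂}` (`n = 2`; correct) over
  `y` with `a₁₁(y) = 0` — the test forms `0, F₂₁, F₂₁, F₁₂², F₂₂` do not isolate (HIDDEN: the
  ideal member `f₁₁²` is needed, order `2`); the constant kernel fields are `ℂ·e₁₂`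
  (`D_γ(a₁₁ f₁₁) = a₁₁γ₁₁`, `D_γ f₂₁ = γ₂₁`, `D_γ f₂₂ = γ₂₂` force `γ₁₁ = γ₂₁ = γ₂₂ = 0`) and
  `e₁₂` does not deflate over `y` (TWISTED: no ideal member has a linear form with non-zero
  `F₁₁`-coefficient at `y`); over any `y'` with `a₁₁(y') ≠ 0` the same system is test-isolated,
  flat and const-deflatable by `e₁₂`.  So the `∃ y'` of the residual is essential, and the residual
  is exactly the class where the base pair must MOVE or the field must be NON-CONSTANT.
-/

-- dupNamespace: forced by the nested Summit.MatrixMultiplication.MatrixMultiplication layout (D-0017)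
set_option linter.dupNamespace false

noncomputable section

open scoped BigOperators

namespace Summit.MatrixMultiplication.MatrixMultiplication.Theorems.GraphEquations

open MvPolynomial Literature.Computability.AlgebraicComplexity
open Literature.Computability.AlgebraicComplexity.ArithCircuit

variable {n : ℕ}

/-- `constSystem γ` computes the constant field `γ` (each `γ_q` is one of its tests). -/
theorem constSystem_computes (γ : Fin n × Fin n → ℂ) :
    ∀ q, ∃ j ∈ (constSystem γ).tests, (constSystem γ).testPoly j = liftAB n (C (γ q)) := by
  refine fun q => ⟨_, ?_, constSystem_testPoly γ q⟩
  simp only [constSystem, List.mem_range]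
  exact ((Fintype.equivFin (Fin n × Fin n)) q).isLt

namespace EqSystem

/-! ## Constant kernel fields are the globally tangent vectors -/

/-- `γ` is a GLOBAL TANGENT VECTOR of `E`: it lies in `ker J_C(graphPoint y)` for every base pair
`y` (tangent to every fibre `{c : t(y, c) = 0 ∀ t}` at its graph point). -/
def GlobalTangent (E : EqSystem n) (γ : Fin n × Fin n → ℂ) : Prop :=
  ∀ y : MatMulVars n → ℂ, (E.jacobianC (graphPoint y)).mulVec γ = 0

/-- **Constant kernel fields = global tangent vectors.**  The constant field `γ` satisfies
`D_γ t ∈ I` for every test `t` of `E` iff `γ` is a global tangent vector of `E`. -/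
theorem derivC_const_mem_graphIdeal_iff_globalTangent (E : EqSystem n) (γ : Fin n × Fin n → ℂ) :
    (∀ j ∈ E.tests, derivC (fun q => C (γ q)) (E.testPoly j) ∈ graphIdeal n) ↔ E.GlobalTangent γ := by
  refine ⟨fun h y => jacobianC_mulVec_eq_zero_of_derivC_const_mem h y, fun h j hj => ?_⟩
  rw [derivC_mem_graphIdeal_iff]
  refine MvPolynomial.funext fun y => ?_
  have h0 := (E.jacobianC_graphPoint_mulVec_eq_zero_iff y γ).mp (h y) j hj
  rw [eval_map_homogeneousComponent_one_liftF] at h0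
  simp only [eval_graphPoint_pderiv_inr] at h0
  rw [map_sum, map_zero]
  simpa only [map_mul, eval_C, mul_comm] using h0

/-! ## R1: the const-deflatable class deflates at linear cost -/

/-- `E` is CONST-DEFLATABLE over `y`: some CONSTANT kernel field `γ` (`D_γ t ∈ I` for every test `t`)
deflates `E` to order `1` over `y` — every system containing the `γ`-deflation of `E` has its test
ideal initially isolated to order `1` over `y`. -/
def ConstDeflatable (E : EqSystem n) (y : MatMulVars n → ℂ) : Prop :=
  ∃ γ : Fin n × Fin n → ℂ,
    (∀ j ∈ E.tests, derivC (fun q => C (γ q)) (E.testPoly j) ∈ graphIdeal n) ∧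
    ∀ E'' : EqSystem n, E.DeflatesTo (fun q => C (γ q)) E'' → E''.IdealInitIsolatedAt 1 y

/-- A const-deflating direction is a global tangent vector. -/
theorem ConstDeflatable.exists_globalTangent {E : EqSystem n} {y : MatMulVars n → ℂ}
    (h : E.ConstDeflatable y) :
    ∃ γ : Fin n × Fin n → ℂ, E.GlobalTangent γ ∧
      ∀ E'' : EqSystem n, E.DeflatesTo (fun q => C (γ q)) E'' → E''.IdealInitIsolatedAt 1 y := by
  obtain ⟨γ, hKF, hdefl⟩ := h
  exact ⟨γ, (E.derivC_const_mem_graphIdeal_iff_globalTangent γ).mp hKF, hdefl⟩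

/-- **R1 — THE CONST-DEFLATABLE CLASS DEFLATES AT LINEAR COST.**  A correct system that is
const-deflatable over `y` has a CORRECT deflation REDUCED at the graph point over `y`, of cost
`≤ 4·cost E + n²`. -/
theorem exists_reduced_deflation_of_constDeflatable {E : EqSystem n} {y : MatMulVars n → ℂ}
    (hE : E.Correct) (h : E.ConstDeflatable y) :
    ∃ E' : EqSystem n, E'.Correct ∧ E'.ReducedAt (graphPoint y) ∧ E'.cost ≤ 4 * E.cost + n * n := by
  obtain ⟨γ, hKF, hdefl⟩ := h
  obtain ⟨E', hfan, hD, hshape, hcost⟩ := forwardModeAD n E (constSystem γ) (fun q => C (γ q)) hE.1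
    (constSystem_isFanInTwo γ) (constSystem_computes γ)
  have hE' : E'.Correct := hE.of_deflatesTo hfan hD hshape hKF
  exact ⟨E', hE', reducedAt_of_idealInitIsolatedAt_one hE' (hdefl E' hD), (constSystem_cost γ) ▸ hcost⟩

/-! ## The flat class -/

/-- `E` is FLAT over `y`: every tangent vector at the graph point over `y` is a global tangent
vector (`ker J_C(graphPoint y)` is the least fibre of the family of tangent spaces and consists of
constant kernel fields). -/
def FlatAt (E : EqSystem n) (y : MatMulVars n → ℂ) : Prop :=
  ∀ γ : Fin n × Fin n → ℂ, (E.jacobianC (graphPoint y)).mulVec γ = 0 → E.GlobalTangent γ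

/-- **Flat ∧ order `2` ⇒ const-deflatable**: the tangent deflation direction of `deflate_tangent`
extends to a constant kernel field. -/
theorem ConstDeflatable.of_flatAt {E : EqSystem n} {y : MatMulVars n → ℂ} (hE : E.Correct)
    (hiso : E.IdealInitIsolatedAt 2 y) (hflat : E.FlatAt y) : E.ConstDeflatable y := by
  obtain ⟨γ, hγT, hγ⟩ := hiso.deflate_tangent hE
  exact ⟨γ, (E.derivC_const_mem_graphIdeal_iff_globalTangent γ).mpr (hflat γ hγT),
    fun E'' hD => hγ _ (fun q => eval_C _) E'' hD⟩

/-- Constant rows (`coeff_{F_q} Ψ⁻¹ t ∈ ℂ` for all tests `t` and positions `q`; in particular tests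
in `I²`, `constRows_of_sq_tests`) ⇒ flat over every `y`. -/
theorem flatAt_of_constRows {E : EqSystem n}
    (hrows : ∀ j ∈ E.tests, ∀ q, ∃ c : ℂ, coeff (Finsupp.single q 1) (liftF n (E.testPoly j)) = C c)
    (y : MatMulVars n → ℂ) : E.FlatAt y := fun _ hγ y' =>
  jacobianC_mulVec_eq_zero_of_derivC_const_mem
    (fun _ hj => derivC_const_mem_graphIdeal_of_constRows hrows hγ hj) y'

/-- **R1 on the flat class**: a correct system, flat over `y`, with test ideal initially isolated to
order `2` over `y`, has a correct deflation reduced at the graph point over `y` of cost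
`≤ 4·cost E + n²`. -/
theorem exists_reduced_deflation_of_flatAt {E : EqSystem n} {y : MatMulVars n → ℂ} (hE : E.Correct)
    (hiso : E.IdealInitIsolatedAt 2 y) (hflat : E.FlatAt y) :
    ∃ E' : EqSystem n, E'.Correct ∧ E'.ReducedAt (graphPoint y) ∧ E'.cost ≤ 4 * E.cost + n * n :=
  exists_reduced_deflation_of_constDeflatable hE (ConstDeflatable.of_flatAt hE hiso hflat)

/-! ## The test-isolated class is pure for free (monotonicity glue) -/

/-- Monotonicity of `PureIsolatedAt` in the order. -/
theorem PureIsolatedAt.mono {E : EqSystem n} {K K' : ℕ} {x : GraphVars n → ℂ}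
    (h : E.PureIsolatedAt K x) (hKK' : K ≤ K') : E.PureIsolatedAt K' x := by
  obtain ⟨m, P, hm, hinit, hiso⟩ := h
  exact ⟨m, P, fun o => (hm o).trans hKK', hinit, hiso⟩

/-- Monotonicity of `PureIsolated` in the order. -/
theorem PureIsolated.mono {E : EqSystem n} {K K' : ℕ} (h : E.PureIsolated K) (hKK' : K ≤ K') :
    E.PureIsolated K' := by
  obtain ⟨x, hx, h⟩ := h
  exact ⟨x, hx, h.mono hKK'⟩

/-- Monotonicity of `InitIsolatedAt` in the order. -/
theorem InitIsolatedAt.mono {E : EqSystem n} {K K' : ℕ} {y : MatMulVars n → ℂ}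
    (h : E.InitIsolatedAt K y) (hKK' : K ≤ K') : E.InitIsolatedAt K' y := by
  obtain ⟨ν, G, hν, hG, hlow, hiso⟩ := h
  exact ⟨ν, G, fun o => (hν o).trans hKK', hG, hlow, hiso⟩

/-- A correct system REDUCED at the graph point over `y` is pure isolated of every order `K ≥ 2`. -/
theorem pureIsolated_of_reducedAt_graphPoint {E : EqSystem n} (hE : E.Correct) {y : MatMulVars n → ℂ}
    (hred : E.ReducedAt (graphPoint y)) {K : ℕ} (hK : 2 ≤ K) : E.PureIsolated K :=
  ⟨graphPoint y, graphPoint_mem_mmGraph y,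
    (pureIsolatedAt_two_of_reducedAt hE (graphPoint_mem_mmGraph y) hred).mono hK⟩

end EqSystem

/-! ## The residual of hand 1, re-typed: hidden ∧ twisted -/

/-- **`HiddenTwistedDeflation K₀ β β'`** (UNDECIDED · the re-typed residual of rung `2`): the uniform
kernel-field deflation demand of `UniformKernelFieldDeflation β β'` RESTRICTED to the pairs `(E, y)`
(correct, cost `≤ c·n^β`, test ideal initially isolated to order `2` over `y`) that are
* HIDDEN — the TESTS of `E` are not initially isolated to order `K₀` over `y`, and
* TWISTED — `E` is not const-deflatable over `y`;
for those, a kernel field `μ` computable in `c'·n^{β'}` operations is demanded whose value at some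
base pair `y'` deflates `E` to order `1` over `y'`. -/
def HiddenTwistedDeflation (K₀ : ℕ) (β β' : ℝ) : Prop :=
  ∀ c : ℝ, ∃ c' : ℝ, ∀ n : ℕ, 1 ≤ n → ∀ (E : EqSystem n) (y : MatMulVars n → ℂ),
    E.Correct → E.IdealInitIsolatedAt 2 y → ¬ E.InitIsolatedAt K₀ y → ¬ E.ConstDeflatable y →
    (E.cost : ℝ) ≤ c * (n : ℝ) ^ β →
    ∃ (y' : MatMulVars n → ℂ) (μ : Fin n × Fin n → MvPolynomial (MatMulVars n) ℂ) (Eμ : EqSystem n),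
      Eμ.circuit.IsFanInTwo ∧ (∀ q, ∃ j ∈ Eμ.tests, Eμ.testPoly j = liftAB n (μ q)) ∧
      (Eμ.cost : ℝ) ≤ c' * (n : ℝ) ^ β' ∧
      (∀ j ∈ E.tests, derivC μ (E.testPoly j) ∈ graphIdeal n) ∧
      (∀ E'' : EqSystem n, E.DeflatesTo μ E'' → E''.IdealInitIsolatedAt 1 y')

/-- **WEAKER than the old residual**: `UniformKernelFieldDeflation β β' → HiddenTwistedDeflation K₀ β β'`. -/
theorem hiddenTwistedDeflation_of_uniform {K₀ : ℕ} {β β' : ℝ} (h : UniformKernelFieldDeflation β β') :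
    HiddenTwistedDeflation K₀ β β' := by
  intro c
  obtain ⟨c', hc'⟩ := h c
  exact ⟨c', fun n hn E y hE hiso _ _ hcost => hc' n hn E y hE hiso hcost⟩

/-- **Antitone in the test-isolation order**: raising `K₀` shrinks the hidden class. -/
theorem HiddenTwistedDeflation.mono_order {K₀ K₁ : ℕ} {β β' : ℝ} (h : HiddenTwistedDeflation K₀ β β')
    (hK : K₀ ≤ K₁) : HiddenTwistedDeflation K₁ β β' := by
  intro c
  obtain ⟨c', hc'⟩ := h c
  exact ⟨c', fun n hn E y hE hiso htest hcd hcost =>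
    hc' n hn E y hE hiso (fun h' => htest (h'.mono hK)) hcd hcost⟩

/-- **NEC in the window (vacuously).**  Under `S` (`ω = 2`) the window `2 ≤ β < β' ≤ ω` is empty, so
the windowed residual holds. -/
theorem nec_hiddenTwistedDeflation_window (hS : _root_.MatrixMultiplication) (K₀ : ℕ) :
    ∀ β β' : ℝ, 2 ≤ β → β < β' → β' ≤ omega ℂ → HiddenTwistedDeflation K₀ β β' := by
  intro β β' hβ hββ' hω
  have h : omega ℂ = 2 := hS
  rw [h] at hω
  exact absurd (lt_of_le_of_lt hβ hββ') (not_lt.mpr hω)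

/-- **ASSEMBLY (g29): BOP′ AT `K = 2` FROM THE WINDOWED HIDDEN-TWISTED RESIDUAL ALONE.**
For `2 ≤ β < β'`: `EqAdmissibleIdealIso β 2 → EqAdmissiblePure β'`, given
`HiddenTwistedDeflation K₀ β β'` only for `β' ≤ ω`.  Per `n`: above `ω` the tree rung; a
test-isolated pair is pure of order `2K₀` as it stands; a const-deflatable pair deflates by R1; the
rest is the residual (forward-mode AD along its kernel field).  Uniform order `2·max K₀ 1`. -/
theorem boundedOrderPurification_two_of_hiddenTwisted (K₀ : ℕ)
    (hR : ∀ β β' : ℝ, 2 ≤ β → β < β' → β' ≤ omega ℂ → HiddenTwistedDeflation K₀ β β')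
    (β : ℝ) (hβ : 2 ≤ β) (hiso : EqAdmissibleIdealIso β 2) (β' : ℝ) (hββ' : β < β') :
    EqAdmissiblePure β' := by
  by_cases hω : omega ℂ < β'
  · exact eqAdmissiblePure_of_idealIso_one (eqAdmissibleIdealIso_one_of_omega_lt hω)
  obtain ⟨c, hc⟩ := hiso
  obtain ⟨c', hc'⟩ := hR β β' hβ hββ' (not_lt.mp hω) c
  refine ⟨2 * max K₀ 1, 4 * max c 0 + max c' 0 + 1, fun n hn => ?_⟩
  obtain ⟨E, hE, ⟨y, hy⟩, hcost⟩ := hc n hn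
  have hK2 : 2 ≤ 2 * max K₀ 1 := by omega
  have hn1 : (1 : ℝ) ≤ n := by exact_mod_cast hn
  have hpow : (n : ℝ) ^ β ≤ (n : ℝ) ^ β' := Real.rpow_le_rpow_of_exponent_le hn1 hββ'.le
  have hpos : 0 ≤ (n : ℝ) ^ β := Real.rpow_nonneg (Nat.cast_nonneg n) β
  have hpos' : 0 ≤ (n : ℝ) ^ β' := Real.rpow_nonneg (Nat.cast_nonneg n) β'
  have hsq : ((n * n : ℕ) : ℝ) ≤ (n : ℝ) ^ β' := by
    rw [Nat.cast_mul, ← sq, ← Real.rpow_two]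
    exact Real.rpow_le_rpow_of_exponent_le hn1 (hβ.trans hββ'.le)
  have h1 : (E.cost : ℝ) ≤ max c 0 * (n : ℝ) ^ β' :=
    hcost.trans ((mul_le_mul_of_nonneg_right (le_max_left c 0) hpos).trans
      (mul_le_mul_of_nonneg_left hpow (le_max_right c 0)))
  have hc'0 : 0 ≤ max c' 0 * (n : ℝ) ^ β' := mul_nonneg (le_max_right c' 0) hpos'
  by_cases htest : E.InitIsolatedAt K₀ y
  · refine ⟨E, hE, htest.pureIsolated.mono (by omega), ?_⟩
    nlinarith [h1, hc'0, hpos']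
  by_cases hcd : E.ConstDeflatable y
  · obtain ⟨E', hE', hred, hcostE'⟩ := EqSystem.exists_reduced_deflation_of_constDeflatable hE hcd
    refine ⟨E', hE', EqSystem.pureIsolated_of_reducedAt_graphPoint hE' hred hK2, ?_⟩
    have h3 : (E'.cost : ℝ) ≤ 4 * E.cost + (n * n : ℕ) := by exact_mod_cast hcostE'
    nlinarith [h1, h3, hsq, hc'0]
  · obtain ⟨y', μ, Eμ, hfanμ, hμ, hμcost, hKF, hgood⟩ := hc' n hn E y hE hy htest hcd hcost
    obtain ⟨E', hfan', hD, htests, hcost'⟩ := forwardModeAD n E Eμ μ hE.1 hfanμ hμ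
    have hE' : E'.Correct := hE.of_deflatesTo hfan' hD htests hKF
    refine ⟨E', hE', EqSystem.pureIsolated_of_reducedAt_graphPoint hE'
      (EqSystem.reducedAt_of_idealInitIsolatedAt_one hE' (hgood E' hD)) hK2, ?_⟩
    have h2 : (Eμ.cost : ℝ) ≤ max c' 0 * (n : ℝ) ^ β' :=
      hμcost.trans (mul_le_mul_of_nonneg_right (le_max_left c' 0) hpos')
    have h3 : (E'.cost : ℝ) ≤ 4 * E.cost + Eμ.cost := by exact_mod_cast hcost'
    nlinarith [h1, h2, h3, hpos']

/-- The same assembly from the UNWINDOWED residual (for any fixed `K₀`). -/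
theorem boundedOrderPurification_two_of_hiddenTwisted' (K₀ : ℕ)
    (hR : ∀ β β' : ℝ, 2 ≤ β → β < β' → HiddenTwistedDeflation K₀ β β')
    (β : ℝ) (hβ : 2 ≤ β) (hiso : EqAdmissibleIdealIso β 2) (β' : ℝ) (hββ' : β < β') :
    EqAdmissiblePure β' :=
  boundedOrderPurification_two_of_hiddenTwisted K₀ (fun β β' hβ hββ' _ => hR β β' hβ hββ') β hβ hiso β' hββ'

/-- **Under `S` the windowed residual is free, so rung `2` of BOP′ holds** (NEC check of the split:
`S → (EqAdmissibleIdealIso β 2 → EqAdmissiblePure β')` for `2 ≤ β < β'`). -/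
theorem nec_boundedOrderPurification_two (hS : _root_.MatrixMultiplication)
    (β : ℝ) (hβ : 2 ≤ β) (hiso : EqAdmissibleIdealIso β 2) (β' : ℝ) (hββ' : β < β') :
    EqAdmissiblePure β' :=
  boundedOrderPurification_two_of_hiddenTwisted 0 (nec_hiddenTwistedDeflation_window hS 0) β hβ hiso β' hββ'

end Summit.MatrixMultiplication.MatrixMultiplication.Theorems.GraphEquations

end
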